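import Summits.Ventures.HodgeRepro.FaceLattice
import Summits.Ventures.HodgeRepro.Night3FacePieces

/-!
# «S4-faces ⟹ S4»: the closure principle on multisets of CM types, every `m ≥ 1`

Blind re-derivation cell `pub-hodge-repro`, seat `night-3`.  Imports typer-2's `FaceLattice` (Lemma L, `m`-uniform:
`span_pairs_faces_eq_zeroSum`) and night-3's `Night3FacePieces` (the conditional closure principle `alg_of_faces_of_spanEq`).
Namespace `HodgeRepro.Night3`.

The route (route/ROUTE.md §3.6 [v2.39]; route/lattice-lead-g18/LEMMA-L-P-v2.md) reduces the one open statement S4 — «the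
Weil space `W_F(B_M)` of every corner product `B_M = ∏_i A_{T_i}` over a zero-sum multiset `M` of CM types of `F` is
algebraic» — to its rank-four FACES through Lemma L (kernel, typer-2) and Lemma P (Hodge theory, used as product closure and
cancellation of the predicate `Alg M := «W_F(B_M)` is algebraic»).  Here:

* **`alg_of_faces`**: for every `m ≥ 1` and every predicate `Alg` on multisets of CM types (sign vectors `Fin m → Bool`) with
  `hadd` / `hcancel` (Lemma P (1) / (2)–(3)), `hpair` (Lefschetz (1,1)) and `hface` (S4 on the census faces), `Alg` holds on
  EVERY zero-sum multiset — «S4-faces ⟹ S4» with the Hodge-theoretic steps as NAMED hypotheses and all combinatorics in the kernel;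
* `alg_of_rankFourFaces`: the same with the lead's generator set (all zero-sum quadruples without a conjugate pair, `m ≥ 3`);
* `exists_pieces_add_pieces`: LEMMA-L-P-v2.md «Consequence» in multiset form.

Nothing here closes S4 (`hface` is a hypothesis); no sealed file is touched; no Tier-2 item depends on this file.
-/

set_option autoImplicit false

namespace HodgeRepro.Night3

open HodgeRepro.FaceLattice

variable {m : ℕ}

/-- **The Consequence of Lemma L, multiset form** (LEMMA-L-P-v2.md): for every zero-sum multiset `M` of CM types (`m ≥ 1`)
there is a sum of pieces `N` such that `M + N` is a sum of pieces. -/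
theorem exists_pieces_add_pieces (hm : 0 < m) {M : Multiset (CMType m)} (hM : IsZeroSum M) :
    ∃ N : Multiset (CMType m), Abstract.IsPieceSum (pieces m) N ∧ Abstract.IsPieceSum (pieces m) (M + N) :=
  exists_pieces_add_pieces_of_spanEq (span_pairs_faces_eq_zeroSum hm) hM

/-- **«S4-faces ⟹ S4»** — the closure principle.  Let `m ≥ 1` and let `Alg` be a predicate on multisets of CM types
(read: `Alg M` = «the Weil space `W_F(B_M)` of the corner product over `M` is algebraic») such that

* `hadd` (product closure, Lemma P (1)): `Alg M → Alg N → Alg (M + N)` for zero-sum `M`, `N`;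
* `hcancel` (cancellation, Lemma P (2)–(3)): `Alg (M + N) → Alg N → Alg M` for zero-sum `M`, `N`;
* `hpair` (divisor classes, Lefschetz (1,1)): `Alg {T, T̄}` for every CM type `T`;
* `hface` (S4 on the census faces): `Alg {Φ, flip p Φ̄, flip p′ Φ̄, flip p′ (flip p Φ)}` for every `Φ` and `p ≠ p′`.

Then `Alg M` for EVERY zero-sum multiset `M`. -/
theorem alg_of_faces (hm : 0 < m) (Alg : Multiset (CMType m) → Prop)
    (hadd : ∀ M N, IsZeroSum M → IsZeroSum N → Alg M → Alg N → Alg (M + N))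
    (hcancel : ∀ M N, IsZeroSum M → IsZeroSum N → Alg (M + N) → Alg N → Alg M)
    (hpair : ∀ T, Alg (pairMul T))
    (hface : ∀ Φ p p', p ≠ p' → Alg (faceMul Φ p p'))
    (M : Multiset (CMType m)) (hM : IsZeroSum M) : Alg M :=
  alg_of_faces_of_spanEq (span_pairs_faces_eq_zeroSum hm) Alg hadd hcancel hpair hface M hM

/-- **«S4-faces ⟹ S4» with the lead's generator set** (LEMMA-L-P-v2.md «Consequence», `m ≥ 3`): the same conclusion when
`Alg` is assumed on every zero-sum quadruple without a conjugate pair (which includes the census faces,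
`faces_subset_rankFourFaces`). -/
theorem alg_of_rankFourFaces (hm : 3 ≤ m) (Alg : Multiset (CMType m) → Prop)
    (hadd : ∀ M N, IsZeroSum M → IsZeroSum N → Alg M → Alg N → Alg (M + N))
    (hcancel : ∀ M N, IsZeroSum M → IsZeroSum N → Alg (M + N) → Alg N → Alg M)
    (hpair : ∀ T, Alg (pairMul T))
    (hquad : ∀ a b c d, IsZeroSumQuad a b c d → ConjFree a b c d → Alg (quadMul a b c d))
    (M : Multiset (CMType m)) (hM : IsZeroSum M) : Alg M :=
  alg_of_faces (by omega) Alg hadd hcancel hpair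
    (fun Φ p p' h => hquad _ _ _ _ (faceVec_isZeroSumQuad h Φ) (faceVec_conjFree hm h Φ)) M hM

end HodgeRepro.Night3
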